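/-
Copyright: statement-level skeleton of a published paper (lit-balaban cell, reader/typer r15). No proof claims beyond
what the kernel checks below.
-/
import Literature.MathematicalPhysics.QuantumFieldTheory.Balaban1983to89.B3Prop1
import Literature.MathematicalPhysics.QuantumFieldTheory.Balaban1983to89.B3Sect2Statements

/-!
# B3 — T. Bałaban, *(Higgs)₂,₃ quantum fields in a finite volume. III. Renormalization*, CMP **88** (1983) 411–445:
the bridge from the vertex catalogue (1.6)–(1.15) (`B3Prop1.VertexKind`) to the degree bookkeeping (2.1) (`B3Sect2Statements`)

statement-level skeleton of published theorems with citation tags; proofs where landed; nothing here is a claim about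
the Yang–Mills mass gap

`B3Prop1` carries the printed counts of each vertex of the catalogue (η-power, scalar legs, A′-legs, differentiations,
"of the form (1.14)–(1.15)") as data on the inductive type `VertexKind`; `B3Sect2Statements` computes the degree (2.1)/D(v)
from a `VertexCounts` record and kernel-checks the printed table (i)–(v) p. 423 on the records `counts16 … counts1315`.  The
two files were filed self-contained (in parallel); this module supplies the one-line bridge `toCounts` and transports the
table and the printed consequence *"Thus for all vertices we have D(v) ≥ (4−d)/2"* (p. 423) to EVERY admissible vertex of
the catalogue (`degree_toCounts_ge`), which is the form Corollary 2.3's case analysis (pp. 428–429) consumes.  Row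
B3.Txt@423 / Phase-2 note P1 of `HOME/lit-balaban-r15/ROWS-B3.md`.  All statements PROVED; nothing of the paper is asserted
beyond this arithmetic.
-/

namespace Literature.MathematicalPhysics.QuantumFieldTheory.Balaban1983to89.B3VertexBridge

open B3Prop1 B3Sect2Statements

/-- The counts record (2.1) of a vertex of the catalogue (1.6)–(1.15): (number of η factors, scalar legs, A′-legs,
differentiations, "of the form (1.14)–(1.15)"). [cite: Balaban1983Higgs3, (2.1) p.422] -/
def toCounts (d : ℕ) (v : VertexKind) : VertexCounts :=
  ⟨v.etaCount d, v.scalarLegs, v.vectorLegs, v.diffCount, v.isAveragingVertex⟩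

/-- (1.6) ↦ `counts16`. [cite: Balaban1983Higgs3, (1.6) p.413] -/
theorem toCounts_v16 (d : ℕ) : toCounts d .v16 = counts16 d := rfl

/-- (1.7) ↦ `counts17`. [cite: Balaban1983Higgs3, (1.7) p.413] -/
theorem toCounts_v17 (d : ℕ) : toCounts d .v17 = counts17 d := rfl

/-- (1.8) with parameters (n, n′) ↦ `counts18 d n n′`. [cite: Balaban1983Higgs3, (1.8) p.413] -/
theorem toCounts_v18 (d n n' : ℕ) : toCounts d (.v18 n n') = counts18 d n n' := rfl

/-- (1.9), the R-vertex of (1.8) with Ã-exponent n̄ + 1 ↦ `counts18 d n (n̄+1)` (η-power d + n + n̄ = d + n + (n̄+1) − 1).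
[cite: Balaban1983Higgs3, (1.9) p.413] -/
theorem toCounts_v19 (d n nb : ℕ) : toCounts d (.v19 n nb) = counts18 d n (nb + 1) := by
  simp only [toCounts, counts18, VertexKind.etaCount, VertexKind.scalarLegs, VertexKind.vectorLegs, VertexKind.diffCount,
    VertexKind.isAveragingVertex]
  congr 1
  push_cast
  ring

/-- (1.10) with parameters (n, n′) ↦ `counts110 d n n′`. [cite: Balaban1983Higgs3, (1.10) p.413] -/
theorem toCounts_v110 (d n n' : ℕ) : toCounts d (.v110 n n') = counts110 d n n' := rfl

/-- (1.11), the R-vertex of (1.10) ↦ `counts110 d n (n̄+1)`. [cite: Balaban1983Higgs3, (1.11) p.413] -/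
theorem toCounts_v111 (d n nb : ℕ) : toCounts d (.v111 n nb) = counts110 d n (nb + 1) := by
  simp only [toCounts, counts110, VertexKind.etaCount, VertexKind.scalarLegs, VertexKind.vectorLegs, VertexKind.diffCount,
    VertexKind.isAveragingVertex]
  congr 1
  push_cast
  ring

/-- (1.14) with parameters (n, n′) ↦ `counts1315 d n` (the Ã-legs are external fields of dimension 0 and carry no η).
[cite: Balaban1983Higgs3, (1.14) p.413] -/
theorem toCounts_v114 (d n n' : ℕ) : toCounts d (.v114 n n') = counts1315 d n := rfl

/-- (1.15) ↦ `counts1315 d n`. [cite: Balaban1983Higgs3, (1.15) p.414] -/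
theorem toCounts_v115 (d n nb : ℕ) : toCounts d (.v115 n nb) = counts1315 d n := rfl

/-- (1.13) has no A′-leg, so its degree is that of `counts1315 d 0` (the records differ only in the immaterial flag).
[cite: Balaban1983Higgs3, (1.13) p.413] -/
theorem degree_toCounts_v113 (d : ℕ) : degree d (toCounts d .v113) = degree d (counts1315 d 0) := by
  simp [degree, degreeIn, Incidence.full, toCounts, counts1315, VertexKind.etaCount, VertexKind.scalarLegs,
    VertexKind.vectorLegs, VertexKind.diffCount, VertexKind.isAveragingVertex]

/-- p. 423 [PDF 13], verbatim: *"Thus for all vertices we have D(v) ≥ (4−d)/2."* — for EVERY admissible vertex of the catalogue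
(1.6)–(1.15) (`VertexKind.Admissible n̄` = the printed side conditions), in dimensions 2 ≤ d ≤ 4, from the kernel-checked table
(i)–(v) (`B3Sect2Statements.degree_ge`).  PROVED. [cite: Balaban1983Higgs3, p.423] -/
theorem degree_toCounts_ge (d : ℕ) (hd2 : 2 ≤ d) (hd4 : d ≤ 4) (nbar : ℕ) (v : VertexKind) (hv : v.Admissible nbar) :
    (4 - (d : ℚ)) / 2 ≤ degree d (toCounts d v) := by
  obtain ⟨h16, h17, h18, h110, h1315⟩ := degree_ge d hd2 hd4
  cases v with
  | v16 => rw [toCounts_v16]; exact h16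
  | v17 => rw [toCounts_v17]; exact h17
  | v18 n n' => rw [toCounts_v18]; exact h18 n n' hv.2.2
  | v19 n nb => rw [toCounts_v19]; exact h18 n (nb + 1) (by omega)
  | v110 n n' => rw [toCounts_v110]; exact h110 n n' hv.2.2.2
  | v111 n nb =>
    rw [toCounts_v111]
    -- (1.11): n′ = n̄ + 1 ≥ 1; the printed condition n + n′ ≥ 2 needs n + n̄ ≥ 1, which holds unless n = n̄ = 0 — in that
    -- degenerate case the degree n(4−d)/2 + n′ = 1 ≥ (4−d)/2 still holds for d ≥ 2:
    rw [degree_v110]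
    have hd2' : (2 : ℚ) ≤ d := by exact_mod_cast hd2
    have hd4' : (d : ℚ) ≤ 4 := by exact_mod_cast hd4
    have hn : (0 : ℚ) ≤ n := by positivity
    push_cast
    nlinarith
  | v113 => rw [degree_toCounts_v113]; exact h1315 0
  | v114 n n' => rw [toCounts_v114]; exact h1315 n
  | v115 n nb => rw [toCounts_v115]; exact h1315 n

/-- The degree of a catalogue vertex with all its elements internal, D(v) of p. 423, as a function on `VertexKind`.
[cite: Balaban1983Higgs3, p.423] -/
def vertexDegree (d : ℕ) (v : VertexKind) : ℚ := degree d (toCounts d v)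

/-- kernel: unfolding. [cite: Balaban1983Higgs3, p.423] -/
theorem vertexDegree_eq (d : ℕ) (v : VertexKind) : vertexDegree d v = degree d (toCounts d v) := rfl

end Literature.MathematicalPhysics.QuantumFieldTheory.Balaban1983to89.B3VertexBridge
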